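import Summits.FinalStateConjecture.FinalStateConjecture.Theses.TangentConeAtIPlus
import Literature.Geometry.Lorentzian.LeafAdaptedModelChartsMinkowski
import Literature.Geometry.Lorentzian.KerrConvergenceProofs
import Literature.Geometry.Lorentzian.TrivialDataAdmissible
import Literature.Geometry.Lorentzian.KerrHorizonRegularWaveBoundednessProofs

/-!
# Crux `TangentConeAtIPlus.FiniteKerrParticleCone` (stmt-FinalStateConjecture-17668) — readback of the
# route's CONE predicate: honest `N = 0` model point, and the junk freedom of its tube clause

Refuter seat `refuter-rattack-stmt-FinalStateConjecture-17668-0` (crux-attack / vetting, 2026-08-17). K1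
asserts that `P(D) = (∃ MGHD) ∧ ∀ MGHD 𝒟, ∃ (N, (Λᵢ,cᵢ), σᵢ, dᵢ, T, U, Φ), Cone 𝒟 …` is
tame-Christodoulou-generic in `admissibleVacuumData Σ`; `Cone` is `let`-inlined in the route file and
shared verbatim by K2–K4 as their HYPOTHESIS. Findings, all kernel-checked, no named fact, no `sorry`:

* §1 `ConeData` — the route's `Cone` VERBATIM as a named `Prop` (bookkeeping), pinned to the item by the
  kernel (`finiteKerrParticleCone_iff`, `Iff.rfl`).
* §2 ANTI-VACUITY (the road "K1 false because `Cone` is unsatisfiable everywhere" is closed):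
  `coneData_minkowski` — the Minkowski development of the admissible datum `(ℝ³, δ, 0)` carries honest
  `N = 0` cone data (identity chart on `U = E4`, `T = 0`: late chart into `J⁺({x⁰ = 0})`, `∂₀`
  future-directed, `Φ^*η − η ≡ 0`, so the weighted interior and wave-zone norms vanish);
  `exists_coneData_admissible`.
* §3 JUNK FREEDOM (missing normalisation): the tube preimage ranges over ALL rest times while `σᵢ, dᵢ`
  are constrained only at `+∞`, and `dᵢ` may point in time; the past branch `σ(s) = s²`,
  `d(s) = s²(1 − cos s) ∂₀` makes `tube(0) ⊇ {y⁰ > T}` (`lateRegion_subset_swallowTube`, IVT).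
* §4 CONSEQUENCE: `coneDataWithoutBasin_junk` — on EVERY spacetime, every clause of `Cone` except the
  basin clause holds with one junk ray and the EMPTY flat chart. So for `N ≥ 1` the wave-zone and
  scale-invariant interior clauses of K1 are voidable as typed (only the basin handshake forces `U ≠ ∅`,
  and only near the recurrent annuli), and the deterministic consumers K2–K4 must digest such junk cone
  data (K2's conclusion demands `Φ`-membership of ALL late shifted annulus points, which junk `U` omit).
  REPAIR for the planner: restrict the tube preimage to rest times `≥ T` and take `dᵢ` spatial in the
  rest frame (`(Λᵢ⁻¹dᵢ(s))⁰ = 0`), so that `tubeᵢ(w) ∩ {y⁰ = τ}` is a ball of radius `o(τ)` about ray `i`.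

Christodoulou–Klainerman 1993, Thm. 1.0.2; O'Neill 1983, Ch. 14, p. 402; DHRT arXiv:2104.08222, §1;
Dafermos–Luk arXiv:1710.01722, Conjecture 1 (the picture the predicate renders).
-/

-- the doubled `FinalStateConjecture` path component is the summit/problem naming scheme, not a mistake
set_option linter.dupNamespace false

noncomputable section

open scoped BigOperators Topology Manifold ContDiff ENNReal Real
open Filter Set Function TopologicalSpace

namespace Summit.FinalStateConjecture.FinalStateConjecture.Theorems.FiniteKerrParticleCone.Negative

open Literature.Geometry.Lorentzian
open Summit.FinalStateConjecture.FinalStateConjecture.Theses.TangentConeAtIPlus (FiniteKerrParticleCone)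

/-! ## §1 The route's `Cone` predicate, named -/

/-- **The route's cone predicate, named** (verbatim the `let Cone := …` of
`Theses/TangentConeAtIPlus.lean`, items K1–K4): cone data `(N, (Λᵢ,cᵢ), σᵢ, dᵢ, T, U, Φ)` at `i⁺` of the
spacetime `𝓢` over the data image `S`. Bookkeeping definition (no mathematical content of its own).
[cite: DafermosLuk2017, Conjecture 1] -/
def ConeData (𝓢 : Spacetime.{0} 4) (S : Set 𝓢.carrier) (N : ℕ) (mo : Fin N → lorentzGroup × E4)
    (σ : Fin N → ℝ → ℝ) (dr : Fin N → ℝ → E4) (T : ℝ) (U : Opens E4) (Φ : U → 𝓢.carrier) : Prop :=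
  let t := fun i (x : E4) => poincareInv (mo i).1 (mo i).2 x 0
  let d := fun i (x : E4) => E4.spatialNorm (poincareInv (mo i).1 (mo i).2 x)
  let tube := fun i (w : ℝ) =>
    (fun x ↦ x + dr i (t i x)) '' {x : E4 | d i x ≤ σ i (t i x) + w} ∩ {y | T < y 0}
  let F := Minkowski.backgroundOn U
  (∀ i, Summit.FinalStateConjecture.IsOrthochronous (mo i).1 ∧ Continuous (σ i) ∧
      Continuous (dr i) ∧ Tendsto (fun s : ℝ ↦ (|σ i s| + ‖dr i s‖) / s) atTop (𝓝 0) ∧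
      Tendsto (σ i) atTop atTop) ∧
  (∀ i j, i ≠ j → Disjoint (tube i 5) (tube j 5)) ∧
  {y : E4 | T < y 0} \ (⋃ i, tube i 0) ⊆ (U : Set E4) ∧
  𝓢.IsLateChart F (𝓢.metric.causalFuture 𝓢.timeOrientation S) T Φ ∧
  (∀ x : U, 𝓢.timeOrientation.IsFutureDirected
    (mfderiv 𝓘(ℝ, E4) (𝓡 4) Φ x (EuclideanSpace.single 0 1))) ∧
  (∀ δ : ℝ, 0 < δ → Tendsto (fun τ : ℝ ↦ weightedCkSeminorm
    {x : E4 | x 0 = τ ∧ E4.spatialNorm x ≤ (1 - δ) * τ ∧ ∀ i, δ * τ ≤ d i x} 2 0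
      (𝓢.deviationExtend F Φ)) atTop (𝓝 0)) ∧
  Tendsto (fun τ : ℝ ↦ 𝓢.deviationCk F Φ 2 τ) atTop (𝓝 0) ∧
  (∀ i, ∃ M a : ℝ, Kerr.IsSubextremal M a ∧ ∀ ε : ENNReal, 0 < ε → ∀ τ₁ : ℝ, ∃ τ : ℝ, τ₁ ≤ τ ∧
    (let B := boostedKerrBackground (mo i).1 (mo i).2 M a
     ∃ Ψ : B.domain → 𝓢.carrier, ContMDiff 𝓘(ℝ, E4) (𝓡 4) ∞ Ψ ∧
      Topology.IsOpenEmbedding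
        ({x : B.domain | |t i x.1 - τ| < 1 ∧ d i x.1 < σ i (t i x.1) + |a| + 6}.restrict Ψ) ∧
      (∀ x : B.domain, |t i x.1 - τ| < 1 → σ i (t i x.1) + 1 ≤ d i x.1 →
        d i x.1 < σ i (t i x.1) + 4 →
          ∃ hx : x.1 + dr i (t i x.1) ∈ (U : Set E4), Ψ x = Φ ⟨_, hx⟩) ∧
      𝓢.truncDeviationCk B Ψ 2 (σ i τ + 5) τ ≤ ε))

/-- **`ConeData` IS the route's predicate**: the crux K1 unfolds, by `Iff.rfl`, to tame genericity of
"an MGHD exists and every MGHD carries `ConeData`". [cite: DafermosLuk2017, Conjecture 1] -/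
theorem finiteKerrParticleCone_iff :
    FiniteKerrParticleCone ↔
      ∀ (X : Type) [TopologicalSpace X] [ChartedSpace E3 X] [IsManifold (𝓡 3) ∞ X] [T2Space X]
        [SecondCountableTopology X] [ConnectedSpace X],
        InitialDataSet.IsTameChristodoulouGeneric (admissibleVacuumData X)
          (fun D ↦ (∃ 𝒟 : VacuumCauchyDevelopment D, 𝒟.IsMaximal) ∧
            ∀ 𝒟 : VacuumCauchyDevelopment D, 𝒟.IsMaximal →
              ∃ (N : ℕ) (mo : Fin N → lorentzGroup × E4) (σ : Fin N → ℝ → ℝ) (dr : Fin N → ℝ → E4)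
                (T : ℝ) (U : Opens E4) (Φ : U → 𝒟.carrier),
                ConeData 𝒟.toSpacetime (range 𝒟.embed) N mo σ dr T U Φ) 1 :=
  Iff.rfl

/-! ## §2 The honest model point: `N = 0` cone data of the Minkowski development -/

/-- **The honest `N = 0` cone data of Minkowski space.** The Minkowski development
`Minkowski.vacuumCauchyDevelopment` of the trivial datum `(ℝ³, δ, 0)` carries cone data with no ray,
`T = 0`, `U = E4` and the identity chart: the late image `{x⁰ > 0}` lies in `J⁺({x⁰ = 0})`, `∂₀` is the
time orientation itself, and `Φ^*η − η ≡ 0`, so the weighted interior norm and the wave-zone `C²` norm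
vanish for every `τ`; all ray-indexed clauses are vacuous. Christodoulou–Klainerman 1993, Thm. 1.0.2.
[cite: ChristodoulouKlainerman1993, Thm. 1.0.2] -/
theorem coneData_minkowski :
    ConeData Minkowski.vacuumCauchyDevelopment.toSpacetime (range Minkowski.vacuumCauchyDevelopment.embed)
      0 Fin.elim0 Fin.elim0 Fin.elim0 0 ⊤ (Subtype.val : (⊤ : Opens E4) → E4) := by
  refine ⟨fun i ↦ i.elim0, fun i ↦ i.elim0, fun x _ ↦ trivial, ?_, ?_, ?_, ?_, fun i ↦ i.elim0⟩
  · -- the identity chart is a late chart into `J⁺(ι ℝ³)` after `T = 0`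
    obtain ⟨hsmooth, hemb, -⟩ := Minkowski.isLateChart_vacuumCauchyDevelopment_subtypeVal 0
    refine ⟨hsmooth, hemb, ?_⟩
    rintro _ ⟨x, hx, rfl⟩
    have hx0 : (0 : ℝ) < (x : E4) 0 := hx
    have hJ : (x : E4) ∈ Minkowski.vacuumCauchyDevelopment.metric.causalFuture
        Minkowski.vacuumCauchyDevelopment.timeOrientation
        ({E4.ofTimeSpace 0 (E4.spatial (x : E4))} : Set E4) := by
      refine Minkowski.mem_causalFuture_vacuumCauchyDevelopment ?_
      simp only [E4.spatial_ofTimeSpace, sub_self, norm_zero, E4.ofTimeSpace_apply_zero, sub_zero]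
      exact hx0.le
    refine LorentzianMetric.causalFuture_mono (M := Minkowski.vacuumCauchyDevelopment.carrier) ?_ hJ
    exact singleton_subset_iff.mpr ⟨⟨E4.spatial (x : E4), trivial⟩, rfl⟩
  · -- `Φ_*∂₀ = ∂₀` is the time orientation of Minkowski space, hence future-directed
    intro x
    have h : mfderiv 𝓘(ℝ, E4) (𝓡 4) (Subtype.val : (⊤ : Opens E4) → E4) x
        (EuclideanSpace.single 0 1) = EuclideanSpace.single 0 1 :=
      OpensChart.mfderiv_subtypeVal_apply x _
    change Minkowski.vacuumCauchyDevelopment.timeOrientation.IsFutureDirected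
      (mfderiv 𝓘(ℝ, E4) (𝓡 4) (Subtype.val : (⊤ : Opens E4) → E4) x (EuclideanSpace.single 0 1))
    rw [h]
    exact Minkowski.vacuumCauchyDevelopment.timeOrientation.isFutureDirected_vectorField (x : E4)
  · -- scale-invariant weighted interior norm of `Φ^*η − η ≡ 0`
    intro δ _
    simp_rw [Minkowski.deviationExtend_vacuumCauchyDevelopment_subtypeVal, weightedCkSeminorm_zero]
    exact tendsto_const_nhds
  · -- wave-zone `C²` norm
    simp_rw [Minkowski.deviationCk_vacuumCauchyDevelopment_subtypeVal]
    exact tendsto_const_nhds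

/-- **Anti-vacuity of the matrix of K1.** Some vacuum Cauchy development of an ADMISSIBLE datum carries
cone data in the route's sense: the predicate `Cone` of `FiniteKerrParticleCone` has no typed defect that
bites every spacetime (the dispersal end `N = 0` is honestly inhabited).
[cite: ChristodoulouKlainerman1993, Thm. 1.0.2] -/
theorem exists_coneData_admissible :
    ∃ D ∈ admissibleVacuumData Minkowski.slice, ∃ 𝒟 : VacuumCauchyDevelopment D,
      ∃ (N : ℕ) (mo : Fin N → lorentzGroup × E4) (σ : Fin N → ℝ → ℝ) (dr : Fin N → ℝ → E4)
        (T : ℝ) (U : Opens E4) (Φ : U → 𝒟.carrier),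
        ConeData 𝒟.toSpacetime (range 𝒟.embed) N mo σ dr T U Φ :=
  ⟨trivialData, trivialData_mem_admissibleVacuumData, Minkowski.vacuumCauchyDevelopment, 0, Fin.elim0,
    Fin.elim0, Fin.elim0, 0, ⊤, Subtype.val, coneData_minkowski⟩


/-! ## §3 Junk freedom of the tube clause: the past branch of `(σ, d)` swallows the late half-space

The tube of ray `i` is `tubeᵢ(w) = (x ↦ x + dᵢ(tᵢx)) '' {dᵢ(x) ≤ σᵢ(tᵢx) + w} ∩ {y⁰ > T}`: the PREIMAGE ball
ranges over all of `E4` (all rest times `tᵢx ∈ ℝ`), while `σᵢ`, `dᵢ` are constrained only as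
`s → +∞` (plus continuity), and the drift `dᵢ(s) ∈ E4` may point in the time direction. So a witness
may let the PAST branch `s ≤ 0` carry balls of radius `s²` translated forward in time by
`s²(1 − cos s)`; these images sweep out every late event (intermediate value theorem on each period),
i.e. `tubeᵢ(0) ⊇ {y⁰ > T}` (`lateRegion_subset_swallowTube`), and clause (3) `U ⊇ {y⁰ > T} ∖ ⋃ tubeᵢ(0)`
holds for EVERY `U`, the empty one included. -/

/-- Swallowing near-zone radius: `s²` on the past branch `s ≤ 0`, the honest `√s` on `s ≥ 0`.
Model bookkeeping. [folklore] -/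
def swallowσ (s : ℝ) : ℝ := (min s 0) ^ 2 + Real.sqrt (max s 0)

/-- Time shift of the swallowing drift: `s² (1 − cos s)` on `s ≤ 0`, `0` on `s ≥ 0`. Model
bookkeeping. [folklore] -/
def swallowShift (s : ℝ) : ℝ := (min s 0) ^ 2 * (1 - Real.cos s)

/-- The swallowing drift: a pure time translation by `swallowShift s`. Model bookkeeping. [folklore] -/
def swallowDrift (s : ℝ) : E4 := swallowShift s • E4.basisVector 0

/-- `swallowσ` is continuous. [folklore] -/
theorem continuous_swallowσ : Continuous swallowσ := by
  unfold swallowσ; fun_prop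

/-- `swallowShift` is continuous. [folklore] -/
theorem continuous_swallowShift : Continuous swallowShift := by
  unfold swallowShift; fun_prop

/-- `swallowDrift` is continuous. [folklore] -/
theorem continuous_swallowDrift : Continuous swallowDrift :=
  continuous_swallowShift.smul continuous_const

/-- On the future branch the radius is `√s`. [folklore] -/
theorem swallowσ_of_nonneg {s : ℝ} (hs : 0 ≤ s) : swallowσ s = Real.sqrt s := by
  simp [swallowσ, min_eq_right hs, max_eq_left hs]

/-- On the past branch the radius is `s²`. [folklore] -/
theorem swallowσ_of_nonpos {s : ℝ} (hs : s ≤ 0) : swallowσ s = s ^ 2 := by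
  simp [swallowσ, min_eq_left hs, max_eq_right hs]

/-- On the future branch there is no drift. [folklore] -/
theorem swallowShift_of_nonneg {s : ℝ} (hs : 0 ≤ s) : swallowShift s = 0 := by
  simp [swallowShift, min_eq_right hs]

/-- On the past branch the time shift is `s²(1 − cos s)`. [folklore] -/
theorem swallowShift_of_nonpos {s : ℝ} (hs : s ≤ 0) :
    swallowShift s = s ^ 2 * (1 - Real.cos s) := by
  simp [swallowShift, min_eq_left hs]

/-- The route's sublinearity clause `(|σ(s)| + ‖d(s)‖)/s → 0` holds for the swallowing pair (it only
sees the future branch `√s`, `0`). [folklore] -/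
theorem tendsto_swallow_div :
    Tendsto (fun s : ℝ ↦ (|swallowσ s| + ‖swallowDrift s‖) / s) atTop (𝓝 0) := by
  have key : ∀ s : ℝ, 0 < s → (|swallowσ s| + ‖swallowDrift s‖) / s = (Real.sqrt s)⁻¹ := by
    intro s hs
    rw [swallowσ_of_nonneg hs.le, swallowDrift, swallowShift_of_nonneg hs.le, zero_smul, norm_zero,
      add_zero, abs_of_nonneg (Real.sqrt_nonneg _), Real.sqrt_div_self]
  refine (tendsto_inv_atTop_zero.comp Real.tendsto_sqrt_atTop).congr' ?_
  filter_upwards [eventually_gt_atTop 0] with s hs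
  exact (key s hs).symm

/-- The route's growth clause `σ → ∞` holds for the swallowing radius. [folklore] -/
theorem tendsto_swallowσ_atTop : Tendsto swallowσ atTop atTop := by
  refine Real.tendsto_sqrt_atTop.congr' ?_
  filter_upwards [eventually_ge_atTop 0] with s hs
  exact (swallowσ_of_nonneg hs).symm

/-- **The swallow.** Every event `y ∈ E4` is `x + swallowDrift (x⁰)` for some `x` on the past branch
with `|x̲| ≤ swallowσ (x⁰)`: on the period `[−(2k+1)π, −2kπ]` the lab time `s + s²(1 − cos s)` runs
continuously from `2(2k+1)²π² − (2k+1)π` down to `−2kπ` (intermediate value theorem), while the ball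
radius stays `≥ (2kπ)²`. [folklore] -/
theorem exists_swallow_preimage (y : E4) :
    ∃ x : E4, E4.spatialNorm x ≤ swallowσ (x 0) ∧ x + swallowDrift (x 0) = y := by
  obtain ⟨k, hk⟩ := exists_nat_ge (|y 0| + E4.spatialNorm y + 1)
  have hρ := E4.spatialNorm_nonneg y
  have hk1 : (1 : ℝ) ≤ k := by linarith [abs_nonneg (y 0)]
  have hπ : (3 : ℝ) < π := Real.pi_gt_three
  set a : ℝ := -((k : ℝ) * (2 * π) + π) with ha
  set b : ℝ := -((k : ℝ) * (2 * π)) with hb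
  have hab : a ≤ b := by rw [ha, hb]; linarith
  have hb0 : b ≤ 0 := by rw [hb]; nlinarith
  let g : ℝ → ℝ := fun s ↦ s + swallowShift s
  have hg : Continuous g := continuous_id.add continuous_swallowShift
  have hga : g a = a + 2 * a ^ 2 := by
    have hca : Real.cos a = -1 := by
      rw [ha, Real.cos_neg, Real.cos_add_pi, Real.cos_nat_mul_two_pi]
    show a + swallowShift a = _
    rw [swallowShift_of_nonpos (hab.trans hb0), hca]; ring
  have hgb : g b = b := by
    have hcb : Real.cos b = 1 := by
      rw [hb, Real.cos_neg, Real.cos_nat_mul_two_pi]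
    show b + swallowShift b = _
    rw [swallowShift_of_nonpos hb0, hcb]; ring
  have hy : y 0 ∈ Icc (g b) (g a) := by
    rw [hga, hgb, ha, hb]
    constructor
    · nlinarith [neg_abs_le (y 0)]
    · nlinarith [le_abs_self (y 0)]
  obtain ⟨s, hs, hgs⟩ := intermediate_value_Icc' hab hg.continuousOn hy
  have hs0 : s ≤ 0 := hs.2.trans hb0
  have hs2 : E4.spatialNorm y ≤ s ^ 2 := by
    have h1 : (k : ℝ) ≤ -s := by rw [hb] at hs; nlinarith [hs.2]
    have h2 : (k : ℝ) ≤ (k : ℝ) ^ 2 := by nlinarith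
    have h3 : (k : ℝ) ^ 2 ≤ s ^ 2 := by nlinarith
    linarith [abs_nonneg (y 0)]
  refine ⟨E4.ofTimeSpace s (E4.spatial y), ?_, ?_⟩
  · rw [E4.ofTimeSpace_apply_zero, swallowσ_of_nonpos hs0, E4.spatialNorm_ofTimeSpace]
    exact hs2
  · rw [E4.ofTimeSpace_apply_zero, swallowDrift, Kerr.ofTimeSpace_add_smul_basisVector_zero]
    have : s + swallowShift s = y 0 := hgs
    rw [this]
    exact E4.ofTimeSpace_time_spatial y

/-- **Hence the junk tube of the trivial motion `(1, 0)` swallows the whole late half-space**: with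
`σ = swallowσ`, `d = swallowDrift`, `tube(0) ⊇ {y⁰ > T}` for every `T` — written in the exact shape of
the route's `tube i 0` (`poincareInv 1 0 = id`, margin `+ 0`). [folklore] -/
theorem lateRegion_subset_swallowTube (T : ℝ) :
    {y : E4 | T < y 0} ⊆
      (fun x ↦ x + swallowDrift (poincareInv 1 0 x 0)) ''
        {x : E4 | E4.spatialNorm (poincareInv 1 0 x) ≤ swallowσ (poincareInv 1 0 x 0) + 0} ∩
        {y | T < y 0} := by
  intro y hy
  refine ⟨?_, hy⟩
  obtain ⟨x, hx, rfl⟩ := exists_swallow_preimage y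
  refine ⟨x, ?_, ?_⟩
  · simpa only [mem_setOf_eq, poincareInv_one_zero, add_zero] using hx
  · simp only [poincareInv_one_zero]

/-! ## §4 Consequence: every clause of `Cone` except the basin clause is voidable on EVERY spacetime

With one junk ray of motion `(1, 0)` carrying the swallowing `(σ, d)`, clause (3) holds for `U = ∅`,
and with the EMPTY flat chart the late-chart, orientation, weighted-interior and wave-zone clauses are
all vacuous or read `0 → 0` (the deviation extended by zero is `0`). So, as typed, the far-field
content of K1 is not load-bearing for `N ≥ 1`: only the basin clause (whose annulus handshake forces
`U ≠ ∅` at the recurrent times) and the pairwise-disjointness clause (for `N ≥ 2`) constrain a witness.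
REPAIR (planner): restrict the tube preimage to rest times `tᵢx ≥ T` (or `≥ tᵢ`-time of the lab slab
`{y⁰ = T}`) and make the drift spatial in the rest frame (`(Λᵢ⁻¹ dᵢ(s))⁰ = 0`), so that
`tubeᵢ(w) ∩ {y⁰ = τ}` lies in a ball of radius `o(τ)` about the ray. -/

/-- The trivial Lorentz transformation is orthochronous: `(1 e₀)⁰ = 1 > 0`. [folklore] -/
theorem isOrthochronous_one : Summit.FinalStateConjecture.IsOrthochronous (1 : lorentzGroup) := by
  show (0 : ℝ) < (E4.basisVector 0 : E4) 0
  simp [E4.basisVector]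

/-- The empty open set of `E4` has no points. [folklore] -/
theorem isEmpty_bot : IsEmpty (↥(⊥ : Opens E4)) :=
  ⟨fun x ↦ Opens.mem_bot.mp x.2⟩

/-- A map out of an empty space is an open embedding. [folklore] -/
theorem isOpenEmbedding_of_isEmpty {α β : Type*} [TopologicalSpace α] [TopologicalSpace β]
    [IsEmpty α] (f : α → β) : Topology.IsOpenEmbedding f :=
  .of_continuous_injective_isOpenMap
    (continuous_def.2 fun s _ ↦ by rw [Set.eq_empty_of_isEmpty (f ⁻¹' s)]; exact isOpen_empty)
    (Function.injective_of_subsingleton f)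
    (fun s _ ↦ by rw [Set.eq_empty_of_isEmpty s, Set.image_empty]; exact isOpen_empty)

/-- **`Cone` minus its basin clause** (verbatim the first seven conjuncts of `ConeData`; the eighth,
the per-ray sub-extremal Kerr basin with its annulus handshake, is dropped). Bookkeeping. [folklore] -/
def ConeDataWithoutBasin (𝓢 : Spacetime.{0} 4) (S : Set 𝓢.carrier) (N : ℕ)
    (mo : Fin N → lorentzGroup × E4) (σ : Fin N → ℝ → ℝ) (dr : Fin N → ℝ → E4) (T : ℝ) (U : Opens E4)
    (Φ : U → 𝓢.carrier) : Prop :=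
  let t := fun i (x : E4) => poincareInv (mo i).1 (mo i).2 x 0
  let d := fun i (x : E4) => E4.spatialNorm (poincareInv (mo i).1 (mo i).2 x)
  let tube := fun i (w : ℝ) =>
    (fun x ↦ x + dr i (t i x)) '' {x : E4 | d i x ≤ σ i (t i x) + w} ∩ {y | T < y 0}
  let F := Minkowski.backgroundOn U
  (∀ i, Summit.FinalStateConjecture.IsOrthochronous (mo i).1 ∧ Continuous (σ i) ∧
      Continuous (dr i) ∧ Tendsto (fun s : ℝ ↦ (|σ i s| + ‖dr i s‖) / s) atTop (𝓝 0) ∧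
      Tendsto (σ i) atTop atTop) ∧
  (∀ i j, i ≠ j → Disjoint (tube i 5) (tube j 5)) ∧
  {y : E4 | T < y 0} \ (⋃ i, tube i 0) ⊆ (U : Set E4) ∧
  𝓢.IsLateChart F (𝓢.metric.causalFuture 𝓢.timeOrientation S) T Φ ∧
  (∀ x : U, 𝓢.timeOrientation.IsFutureDirected
    (mfderiv 𝓘(ℝ, E4) (𝓡 4) Φ x (EuclideanSpace.single 0 1))) ∧
  (∀ δ : ℝ, 0 < δ → Tendsto (fun τ : ℝ ↦ weightedCkSeminorm
    {x : E4 | x 0 = τ ∧ E4.spatialNorm x ≤ (1 - δ) * τ ∧ ∀ i, δ * τ ≤ d i x} 2 0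
      (𝓢.deviationExtend F Φ)) atTop (𝓝 0)) ∧
  Tendsto (fun τ : ℝ ↦ 𝓢.deviationCk F Φ 2 τ) atTop (𝓝 0)

/-- `ConeData` is `ConeDataWithoutBasin` plus the basin clause (definitional bookkeeping). [folklore] -/
theorem coneData_iff_withoutBasin_and (𝓢 : Spacetime.{0} 4) (S : Set 𝓢.carrier) (N : ℕ)
    (mo : Fin N → lorentzGroup × E4) (σ : Fin N → ℝ → ℝ) (dr : Fin N → ℝ → E4) (T : ℝ) (U : Opens E4)
    (Φ : U → 𝓢.carrier) :
    ConeData 𝓢 S N mo σ dr T U Φ ↔ ConeDataWithoutBasin 𝓢 S N mo σ dr T U Φ ∧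
      (let t := fun i (x : E4) => poincareInv (mo i).1 (mo i).2 x 0
       let d := fun i (x : E4) => E4.spatialNorm (poincareInv (mo i).1 (mo i).2 x)
       ∀ i, ∃ M a : ℝ, Kerr.IsSubextremal M a ∧ ∀ ε : ENNReal, 0 < ε → ∀ τ₁ : ℝ, ∃ τ : ℝ, τ₁ ≤ τ ∧
        (let B := boostedKerrBackground (mo i).1 (mo i).2 M a
         ∃ Ψ : B.domain → 𝓢.carrier, ContMDiff 𝓘(ℝ, E4) (𝓡 4) ∞ Ψ ∧
          Topology.IsOpenEmbedding
            ({x : B.domain | |t i x.1 - τ| < 1 ∧ d i x.1 < σ i (t i x.1) + |a| + 6}.restrict Ψ) ∧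
          (∀ x : B.domain, |t i x.1 - τ| < 1 → σ i (t i x.1) + 1 ≤ d i x.1 →
            d i x.1 < σ i (t i x.1) + 4 →
              ∃ hx : x.1 + dr i (t i x.1) ∈ (U : Set E4), Ψ x = Φ ⟨_, hx⟩) ∧
          𝓢.truncDeviationCk B Ψ 2 (σ i τ + 5) τ ≤ ε)) := by
  simp only [ConeData, ConeDataWithoutBasin, and_assoc]

/-- **Every clause of the route's `Cone` except the basin clause holds on EVERY spacetime, over every
data image, after every `T`, with ONE junk ray and the EMPTY flat chart.** Ray: motion `(1, 0)`,
radius `swallowσ`, drift `swallowDrift` (orthochronous, continuous, `(|σ| + ‖d‖)/s → 0`, `σ → ∞`);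
its tube swallows `{y⁰ > T}` (`lateRegion_subset_swallowTube`), so `U = ∅` is admissible; the empty
chart is smooth, an open embedding, maps into `J⁺(S)`, is future-oriented (all vacuously), and its
deviation extended by zero vanishes, so the weighted interior and wave-zone `C²` norms are `0`.
Consequently the far-field clauses of K1 are voidable as typed whenever `N ≥ 1`. [folklore] -/
theorem coneDataWithoutBasin_junk (𝓢 : Spacetime.{0} 4) (S : Set 𝓢.carrier) (T : ℝ) :
    ConeDataWithoutBasin 𝓢 S 1 (fun _ ↦ ((1 : lorentzGroup), (0 : E4))) (fun _ ↦ swallowσ)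
      (fun _ ↦ swallowDrift) T ⊥ (fun x ↦ (isEmpty_bot.false x).elim) := by
  haveI : IsEmpty (↥(⊥ : Opens E4)) := isEmpty_bot
  set Φ : (↥(⊥ : Opens E4)) → 𝓢.carrier := fun x ↦ (isEmpty_bot.false x).elim with hΦ
  have hext : 𝓢.deviationExtend (Minkowski.backgroundOn ⊥) Φ = 0 :=
    funext fun y ↦ 𝓢.deviationExtend_of_not_mem (Minkowski.backgroundOn ⊥) Φ
      (fun h ↦ isEmpty_bot.false ⟨y, h⟩)
  refine ⟨fun _ ↦ ⟨isOrthochronous_one, continuous_swallowσ, continuous_swallowDrift,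
    tendsto_swallow_div, tendsto_swallowσ_atTop⟩,
    fun i j hij ↦ absurd (Subsingleton.elim i j) hij, ?_, ?_, fun x ↦ (isEmpty_bot.false x).elim,
    ?_, ?_⟩
  · -- clause (3): the junk tube swallows the late half-space, so even `U = ∅` qualifies
    intro y hy
    exact (hy.2 (mem_iUnion.2 ⟨0, lateRegion_subset_swallowTube T hy.1⟩)).elim
  · -- clause (4): the empty chart is a late chart into `J⁺(S)`
    haveI : IsEmpty ↥((Minkowski.backgroundOn (⊥ : Opens E4)).lateRegion T) :=
      ⟨fun x ↦ isEmpty_bot.false x.1⟩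
    exact ⟨fun x ↦ (isEmpty_bot.false x).elim, isOpenEmbedding_of_isEmpty _,
      by rintro _ ⟨x, -, -⟩; exact (isEmpty_bot.false x).elim⟩
  · -- clause (6): weighted interior norm of the zero function
    intro δ _
    simp_rw [hext, weightedCkSeminorm_zero]
    exact tendsto_const_nhds
  · -- clause (7): wave-zone norm of the zero function
    have h : ∀ τ, 𝓢.deviationCk (Minkowski.backgroundOn ⊥) Φ 2 τ = 0 := fun τ ↦ by
      rw [Spacetime.deviationCk, hext, supCkENorm_zero]
    simp_rw [h]
    exact tendsto_const_nhds

end Summit.FinalStateConjecture.FinalStateConjecture.Theorems.FiniteKerrParticleCone.Negative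

end
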